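import Mathlib
import HarnessLib
import HarnessLib.Audit
import Summits.AtomisticToContinuum.Statement
import Literature.MathematicalPhysics.KineticTheory.LangevinChainKernel
import Literature.MathematicalPhysics.KineticTheory.LangevinChainGibbs
import Literature.MathematicalPhysics.KineticTheory.LangevinChainNESSHolds
import Summits.AtomisticToContinuum.FouriersLaw.Theorems.EmbeddedDrudeMourreNessUnique
import HarnessLib.Audit.Status.Attr

/-!
Route: PhononMeanFreePath

DORMANT since 2026-08-24T07:12:59Z (reconciler: no traction for 6.6 d (last activity item-evidence-added at 2026-08-17T16:50:49Z); parked, not closed — `ledger route dormant route-AtomisticToContinuum-PhononMeanFreePath --off` to reacti) — unstaffed, not closed; items shared with open routes are served there. `ledger route dormant <id> --off` reactivates.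

# Route PhononMeanFreePath — phonons die before heat diffuses — close the Landauer channel, weigh
the cumulant channel

X_PMFP (TWO CHANNELS OF THE BATH-TO-BATH CONDUCTANCE; spine card phonon-lifetime-one-particle-sector
supplies the engine, card
two-channel-dephasing the split; D-0027 §2.1-CONFORMING RE-OPEN of the retired routes PhononLifetime
/ TwoChannelDephasing — same
kernel-typed statements, now with the deciding theorem `closes : NessUnique → BoundaryKubo →
CoherentDephasing → IncoherentChannel →
FouriersLaw` PROVED sorry-free in the planner folder against the Statement decl `FouriersLaw`).
Chain of N+1 sites 0..N,
P = pinnedChain ω₂ lam β γ (all four > 0), T > 0, μ₀ = P.gibbsMeasure (N+1) T, K_t =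
P.transitionKernel (N+1) T T t the CONSTRUCTED
equal-temperature Langevin kernels; r_N(t) := ∫ p_0 · K_t p_N dμ₀ (T × the thermally averaged
end-to-end impulse response, classical FDT),
C_N(t) := Cov_μ₀(p_0², K_t p_N²). It suffices to show X = (K) ∧ (A) ∧ (B): (K) BoundaryKubo — under
weak-NESS uniqueness BLR's response
coefficient exists and D_(N+1) = N(γ²/T²)∫₀^∞ C_N; (A) CoherentDephasing — N∫₀^∞ r_N² → 0: the
non-negative two-point (coherent,
Landauer) part 2γ²T⁻²N∫r_N² of (K), which at lam = β = 0 is the WHOLE ballistic conductance, dies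
because thermal phonons have a finite
mean free path ℓ(T); (B) IncoherentChannel — N(γ²/T²)∫₀^∞[C_N − 2r_N²] → κ(T) ∈ (0,∞): the connected
four-point channel carries Fourier's
law. Since Cov(X²,Y²) = 2E[XY]² + cum₄, D_(N+1) = coherent + incoherent exactly, so D_N → 0 + κ(T);
with NessUnique (shared 0741) and the
PROVED existence fact pinnedChain_exists_isSteadyState this is FouriersLawFor at every parameter
point, i.e. FouriersLaw.
Lean: `NessUnique ∧ BoundaryKubo ∧ CoherentDephasing ∧ IncoherentChannel`

## Assembly
Pure logic plus linearity of the Bochner integral, PROVED sorry-free in the planner folder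
(Sketch.lean / glue.lean, theorem closes,
~45 lines incl. two real-analysis lemmas inlined, axioms propext / Classical.choice / Quot.sound):
clause (i) from the proved fact
pinnedChain_exists_isSteadyState (N = 0 included) + NessUnique; κ T := the witness of
IncoherentChannel at T (choice; 1 for T ≤ 0),
positive by the crux; for a steady-state family μ set D 0 := 0 (totalCurrent_zero) and D (N+1) :=
N(γ²/T²)∫C_N, whose δ-limits are
BoundaryKubo; then D (N+1) = N(γ²/T²)∫(C_N − 2r_N²) + 2(γ²/T²)·(N∫r_N²) by integral_sub
(integrability from BoundaryKubo and
CoherentDephasing) → κ(T) + 0 (tendsto_add_atTop_iff_nat). The conclusion is the sub-problem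
Statement decl `FouriersLaw` by name.

Rationale: WHY THIS LINE. BLR take δT → 0 first, so D_N is an EQUILIBRIUM object of the finite open chain, and
the open-system Kubo formula in CROSS form
(KunduDharNarayan2009 p.3; JaksicOgataPillet2006 §2.4; MaesNetocnyVerschuere2003) writes the
two-terminal conductance as the
time-integrated covariance of the two END kinetic energies; the Gaussian cumulant identity then
confines the entire harmonic obstruction
(RiederLebowitzLieb1967; barrier HarmonicChainBallisticFlux) to ONE signed two-point term, the mean
Green's function of a linear wave in
the dynamic disorder the chain generates itself (waves-in-random-media dictionary, imported from
mesoscopic transport: ⟨G⟩ ↔ r_N dies on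
the scattering mean free path, ⟨GG*⟩ ↔ cum₄ channel carries transport). The engine for (A) is
imported from spectral/scattering theory of
thermal Liouvillians: on the first chaos of L²(Gibbs) of the infinite chain the phonon branch ±ω(k),
ω(k)² = ω₂ + 4sin²(k/2), is a
k-fibred family of embedded eigenvalues of the Koopman generator at NONZERO frequency, coupled by
the quartic vertex to the 2↔2 thermal
continuum whose resonant manifold is non-trivial at every k for the gapped band (Lukkarinen2016
§2.2, AokiLukkarinenSpohn2006 §3), so
Fermi-golden-rule/positive-commutator analysis (JaksicPillet1998 classical Koopman setting;
Merkli2001, BachFrohlichSigal2000) should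
dissolve it at fixed small effective coupling (lam·T, β·T) — 'beyond the kinetic time', where
LukkarinenSpohn2010 stops; by phase-space
inversion parity r_N lives in the ODD sector, orthogonal to every functional of the conserved energy
field, so only an odd hidden charge
(total momentum, removed by pinning) could feed the coherent channel (Mazur) and the pinning gap √ω₂
keeps every transmitted frequency
away from 0 where dephasing switches off (LukkarinenSpohn2008, the unpinned root of anomaly). Versus
the open routes: FourierGreenKubo /
KineticCorner work with the bulk current autocorrelation of the INFINITE chain,
OddSectorIrreversibility / BondHeatUncertainty /
CurrentTiltQuench bound the odd part of the response density or a bond-heat variance; none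
decomposes D_N itself at the two bath sites
into a dephasing statement carrying the harmonic obstruction plus a boundary-localised four-point
statement carrying κ. Negatives index
(6 refuted statements, none in FouriersLaw) untouched.

RANKED CRUXES. #2 CoherentDephasing (crux) — COHERENT (LANDAUER) CHANNEL CLOSES (card
phonon-lifetime N3/N4 = card two-channel-dephasing NA; signature of stmt-3303 verbatim): for all ω₂,
lam, β, γ > 0 and T > 0, t ↦ r_N(t)² is integrable on (0,∞) for every N and N·∫₀^∞ r_N(t)² dt → 0 as
N → ∞ (conjecturally ≤ C N e^(−N/ℓ(T)), ℓ ~ (lam·T)⁻² the thermal phonon mean free path);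
equivalently the coherent channel N·G^coh = 2γ²T⁻²N∫r_N² closes. r_N(t)/T is the Gibbs- and
noise-averaged response of p_N at time t to a unit kick on p_0 (classical FDT); at lam = β = 0 it
does NOT close (HarmonicCoherentPersistence). Engines: (i) FGR/positive commutators for the k-fibred
phonon branch of the thermal Koopman generator of the infinite chain + contact transfer; (ii)
averaged tangent flow = wave in self-generated dynamic disorder, Dyson resummation controlled by the
gapped 1-D transfer operator; (iii) inhomogeneous dephasing / De Roeck–Huveneers decoupling at
strong anharmonicity. [difficulty: XL] (why it might fail: Needs N-uniform dephasing of the AVERAGED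
response at FIXED coupling beyond kinetic times (LS2010 stop at t~λ⁻²); a band with vanishing
thermal scattering, finite-N transmission resonances or coherent nonlinear carriers would leave ≥
c/N; ℓ(T)~(lam·T)⁻², nothing uniform in T.) [LukkarinenSpohn2010, LukkarinenSpohn2010ICMP,
Lukkarinen2016, AokiLukkarinenSpohn2006, Spohn2006PhononBoltzmann, JaksicPillet1998, Merkli2001,
DeRoeckHuveneers2015, RiederLebowitzLieb1967, Dhar2008]
#3 IncoherentChannel (crux) — INCOHERENT (FOUR-POINT) CHANNEL CARRIES κ (card two-channel-dephasing
NB; stmt-3304 verbatim): for all parameters > 0 and T > 0 there is κ(T) > 0, chosen before N, with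
N·(γ²/T²)∫₀^∞[C_N(t) − 2r_N(t)²] dt → κ(T) as N → ∞, i.e. the time-integrated connected fourth
cumulant cum₄(p_0(0),p_0(0),p_N(t),p_N(t)) of the two END momenta of the equilibrium open chain
decays exactly like κ(T)T²/(γ²N) (junk-robust: a non-integrable summand gives 0, incompatible with κ
> 0). With BoundaryKubo and CoherentDephasing this is D_N → κ(T); stand-alone it is an
equilibrium-dynamics statement about two bath-site observables, the coordinates on which the
dissipative part of the generator acts, integrated over diffusive times t ~ N². [deps: BoundaryKubo,
CoherentDephasing] [difficulty: open-problem] (why it might fail: Green–Kubo depth in boundary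
clothes: an N-uniform bound on a TIME-INTEGRATED connected 4-point function over t~N², existence of
the limit AND κ>0, while fixed-N mixing rates close (L² gap ≲ N⁻³ harmonically, BeckerMenegaki2022);
an odd hidden charge makes it diverge.) [BonettoLebowitzReyBellet2000, KunduDharNarayan2009,
JaksicOgataPillet2006, MaesNetocnyVerschuere2003, BeckerMenegaki2022, SaaskilahtiEtAl2012,
CanestrariLiveraniOlla2026]
#4 BoundaryKubo (crux) — BOUNDARY (CROSS-FORM) KUBO IDENTITY (card two-channel-dephasing N0;
stmt-3305 verbatim): for all parameters > 0, ASSUMING uniqueness of weak steady states (hypothesis =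
NessUnique): for every steady-state family μ, T > 0 and N, C_N ∈ L¹(0,∞) and totalCurrent(μ (N+1)
(T+δ/2) (T−δ/2))/δ → N·(γ²/T²)·∫₀^∞ C_N as δ → 0, δ ≠ 0 (existence AND value of BLR's D_(N+1); the
empty chain has D = 0 by totalCurrent_zero). Derivation: ∂_(T_L)L = γ∂²_(p_0) and Gaussian IBP give
∂_(T_L)μ(A) = (γ/T²)∫₀^∞ Cov_μ₀(p_0², K_t A) dt; A = γ(p_N² − T_R) is the power absorbed by the
right bath = J̃ in a steady state; the symmetric protocol equals ∂_(T_L)J̃ by the left/right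
reflection symmetry of pinnedChain (U uniform, V even); totalCurrent = N·J̃. Harmonic check:
Gaussian ⇒ cum₄ = 0 ⇒ G_N = 2γ²T⁻²∫r_N² = Landauer (card two-channel-dephasing: 5-digit numerical
agreement). [deps: NessUnique] [difficulty: L] (why it might fail: Fixed-N yet unproved for Langevin
baths: δ-differentiability of the weak NESS mean of γp_N² at equilibrium (HairerMajda2009 Ass. 1–3;
their SDE Thm 4.4 Ass. 5 fails for cubic forces), Dynkin/IBP beyond C_c^∞, Gibbs invariance of the
kernels; a slip breaks only the constant.) [KunduDharNarayan2009, JaksicOgataPillet2006,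
MaesNetocnyVerschuere2003, ReyBellet2003, HairerMajda2009, CuneoEckmannHairerReyBellet2018,
BonettoLebowitzReyBellet2000]
#9 NessUnique (support) — UNIQUENESS OF THE WEAK STEADY STATE (shared verbatim, stmt-0741, 20+
routes): for pinnedChain (all > 0), every N and T_L, T_R > 0, any two measures in the weak
Fokker–Planck class IsSteadyState coincide; with the PROVED fact pinnedChain_exists_isSteadyState
(LangevinChainNESSHolds) it gives clause (i) of FouriersLawFor and makes D_N canonical. Print:
CEHR2018 Thm 2.13(1) / Carmona2007 + the FP-identification lemma (Echeverría 1982 = Ethier–Kurtz Thm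
4.9.17 ∘ SV well-posedness ∘ non-explosion), recorded retriage plan of 0741. [difficulty: L]
[CuneoEckmannHairerReyBellet2018, Carmona2007]
#9 CoherentDephasingWeakCoupling (support) — REGIME SPECIAL CASE OF THE RANK-2 CRUX (card
phonon-lifetime N2, the Mourre/FGR corner; NEW signature): for every ω₂, γ > 0 there is ε₀(ω₂,γ) > 0
such that the conclusion of CoherentDephasing holds for all lam, β, T > 0 with lam·T ≤ ε₀ and β·T ≤
ε₀ (by the proved scaling conjugacy (lam,β,T) ≡ (lam·T, β·T, 1) the statement depends on the two
effective couplings only; ℓ ~ (lam·T)⁻² may blow up as ε₀ → 0, only N → ∞ at fixed parameters is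
asserted). The stand-alone publishable target 'finite thermal phonon lifetime beyond the kinetic
time at fixed small coupling'; foreseen child of a regime split of CoherentDephasing (planner
Sketch: CoherentDephasing → CoherentDephasingWeakCoupling, rfl-level). [difficulty: XL]
[LukkarinenSpohn2010, JaksicPillet1998, Merkli2001, BachFrohlichSigal2000, Lukkarinen2016,
AokiLukkarinenSpohn2006]
#9 HarmonicCoherentPersistence (support) — CALIBRATION / NEGATIVE SIDE AT THE INTEGRABLE CORNER
(stmt-3306 verbatim): for the pinned HARMONIC chain (lam = β = 0; ω₂, γ, T > 0) the coherent channel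
does NOT close: r_N² ∈ L¹ for all N and ¬(N∫₀^∞ r_N² → 0) — indeed 2γ²T⁻²∫r_N² is the
Rieder–Lebowitz–Lieb/Landauer conductance c_N → c_∞ > 0 (the OU process is Gaussian, cum₄ ≡ 0;
Parseval on the transmission formula). Checks that r_N is typed with the right normalisation and
that CoherentDephasing is exactly the harmonic/anharmonic divide; provable from
LinearLangevinGaussian + HarmonicChainNESS/HarmonicChainFlux once the OU kernels are identified with
transitionKernel at lam = β = 0. [difficulty: M] [RiederLebowitzLieb1967, Nakazawa1970,
CasherLebowitz1971, Dhar2008, RoyDhar2008]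
#9 IncoherentBounded (support) — THE INCOHERENT CHANNEL IS BOUNDED UNIFORMLY IN N (stmt-3307
verbatim; the finiteness half of IncoherentChannel): for all parameters > 0 and T > 0, sup_N
|N·(γ²/T²)·∫₀^∞(C_N − 2r_N²)| < ∞ (boundary localisation of the observables at the dissipative sites
should let hypocoercive/Malliavin estimates bite uniformly in N); with BoundaryKubo and
CoherentDephasing it yields the catalogued waypoint BoundedResponse (ChannelsBoundedResponse).
[difficulty: XL] [BonettoLebowitzReyBellet2000, BonettoLebowitzLukkarinenOlla2009,
BeckerMenegaki2022]
#9 BoundedResponse (support) — BOUNDED RESPONSE, the catalogued necessary waypoint written out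
(stmt-11071 verbatim = Literature.Barriers.AtomisticToContinuum.HasBoundedResponse (pinnedChain ω₂
lam β γ) unfolded, shared with routes BondHeatUncertainty / OddSectorIrreversibility): along every
steady-state family and every T > 0, if the response limits D_N exist for all N then (|D_N|)_N is
bounded. Necessary for the conjunct (hasBoundedResponse_of_fouriersLawFor, proved) and FALSE at lam
= β = 0 (HarmonicChainBallisticFlux.not_hasBoundedResponse); in THIS route it is an OUTPUT of the
coherent closing plus the bounded incoherent channel (ChannelsBoundedResponse) — the card's
deliverable 'the coherent part of bounded response'. [difficulty: open-problem]
[BonettoLebowitzReyBellet2000, BonettoLebowitzLukkarinenOlla2009]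
#9 ChannelsBoundedResponse (support) — PARTIAL ASSEMBLY (glue, PROVED in the planner's Sketch.lean
as channelsBoundedResponse_holds, ~35 lines, axioms propext/Classical.choice/Quot.sound): NessUnique
→ BoundaryKubo → CoherentDephasing → IncoherentBounded → BoundedResponse (response coefficients
identified by tendsto_nhds_unique, D_(N+1) split by integral_sub, coherent part bounded because
convergent). [difficulty: provable-now] [BonettoLebowitzReyBellet2000]

TWO-LAYER PLAN. Foreseen glued splits (none filed now; k ≤ 3, depth 1): CoherentDephasing ⇐
InfiniteVolumePhononLifetime → ContactTransfer →
CoherentDephasing, where InfiniteVolumePhononLifetime is the spine card's own object — for the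
infinite chain in a Gibbs state
(IsChainGibbsMeasure) with a measure-preserving InfiniteChainDynamics the momentum pair correlation
C_x(t) = ⟨p_0(0)p_x(t)⟩_T satisfies
Σ_x e^(|x|/ℓ)∫₀^∞C_x(t)²dt < ∞ (x-space form of 'k ↦ S_T(k,ω) analytic in a strip': dissolution of
the k-fibred embedded phonon branch;
FALSE at lam = β = 0 where even ∫₀^∞C_x² dt = ∞ by the band-edge t^(−1/3) decay), and
ContactTransfer bounds the open chain's r_N by the
bulk propagator times O(1) contact factors (thermostat scattering of phonons, KomorowskiOlla2020);
ALTERNATIVELY the regime split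
CoherentDephasing ⇐ CoherentDephasingWeakCoupling (filed as support) → StrongCouplingDephasing →
CoherentDephasing (glue = case split on
max(lam·T, β·T) ≤ ε₀). IncoherentChannel ⇐ IncoherentBounded (filed) → ExistenceOfLimit (Fekete-type
quasi-subadditivity of the
resistance N/D_N) → Positivity → IncoherentChannel. BoundaryKubo ⇐ ResponseFormula (first-order
perturbation of the weak steady state
in the bath temperatures) → SumRuleReflection → BoundaryKubo.

KILL CRITERIA. CoherentDephasing refuted — a proof that N∫₀^∞r_N² ↛ 0 for some admissible
(ω₂,lam,β,γ,T), e.g. an odd conserved quantity transporting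
the kick coherently or a band with zero thermal scattering — closes the route (close --reason
refuted:CoherentDephasing); if moreover
N·G_N^coh → ∞ it refutes BoundedResponse and hence the conjunct (file ¬FouriersLaw).
IncoherentChannel refuted while BoundaryKubo and
CoherentDephasing stand ⇒ D_N ↛ any κ > 0 ⇒ ¬FouriersLaw outright (negative route). BoundaryKubo
refuted as an identity (wrong constant /
missing term) ⇒ pivot by restating (K) in the Kundu–Dhar–Narayan auto-form D_N =
(N−1)T⁻²∫⟨j̄(0)J(t)⟩dt and re-deriving the split;
refuted because D_N is not given by linear response at all ⇒ every Kubo-type route dies with it.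
HarmonicCoherentPersistence FALSE signals
a normalisation error in (A)/(K), not a dead line. FourierGreenKubo's GreenKubo + ThermodynamicLimit
proved first moots (B) but not (A),
which stays a stand-alone theorem (finite thermal phonon mean free path).

NOT DECOMPOSED YET. The engine inside CoherentDephasing (conjugate operator and limiting absorption
for the k-fibred thermal Koopman generator; the
collinear-collision threshold that makes the d = 1 second-order width log-divergent, Lukkarinen2016
§3.3; the change of measure from the
Gaussian to the quartic Gibbs state via the gapped 1-D transfer operator); the infinite-volume
objects themselves (a definition request
for the momentum spectral function S_T(k,ω) as a positive measure on 𝕋×ℝ is deferred to the first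
split; InfiniteChainDynamics /
IsChainGibbsMeasure exist); contact factors at the bathed ends; the hydrodynamic window of
IncoherentChannel and any κ = κ_GK
identification; T-dependence of κ; Gibbs invariance of the constructed kernels and the
FP-identification lemma behind NessUnique (shared
infrastructure, provers attach with --supports).

CHEAPEST FALSIFIER. Equilibrium molecular dynamics of pinnedChain 1 1 1 1 with Langevin ends (γ = 1)
at T ∈ {0.3, 1, 3}, N ∈ {4, 8, 16, 32, 64}: estimate
r_N(t) = ⟨p_0(0)p_N(t)⟩ (Gibbs initial data, noise average) and C_N(t); check (1) N·∫r_N² decays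
(expected exponentially, slope 1/ℓ(T)
increasing with T), (2) N(γ²/T²)∫C_N ≈ D_(N+1) from a small-δT NEMD run (BoundaryKubo), (3) the lam
= β = 0 control reproduces the
RLL/Landauer conductance (card two-channel-dephasing reports 5-digit agreement). A flat N∫r_N² at
any T kills CoherentDephasing; a
mismatch in (2) kills the constant in BoundaryKubo. Lookup done (gen-0 planner, Lukkarinen2016
§2.2/§3.3): with pinning the 2↔2 resonant
manifold is non-trivial at every k₀ and the loss rate positive (indeed formally +∞), so no kinematic
transparent band exists at second
order. Not run here (compute-free hub, no kit budget in this plancard unit).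

NUMBERS. G_N ≤ γ (sum rule (γ²/T²)(∫X + ∫Y) = γ with ∫Y ≥ 0); single-contact value γ/2. Harmonic
corner: G_N = G_N^coh → positive RLL limit,
flux ∝ δT independent of N (RiederLebowitzLieb1967, Nakazawa1970; tree: HarmonicChainBallisticFlux,
fluxCoeff). Kinetic corner:
κ ∝ (lam·T)⁻² (AokiLukkarinenSpohn2006; Lukkarinen2016 §3.4), hence expected ℓ(T) ∝ (lam·T)⁻² and
N₀(ε) ~ ℓ log(1/ε) in
CoherentDephasing; second-order one-phonon loss rate formally infinite for all k₀ in d = 1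
(Lukkarinen2016 §3.3). Items at open: 10
(3 cruxes, 6 support, 1 assembly); 7 of the 10 signatures are verbatim re-filings (3303, 3304, 3305,
3306, 3307, 0741, 11071).

DEFINITION REQUESTS. None at open: OscillatorChain.transitionKernel (LangevinChainKernel.lean),
gibbsMeasure (LangevinChainGibbs.lean), IsSteadyState /
totalCurrent / FouriersLaw exist and every item elaborates (Sketch.lean rc 0, 0 sorries). Deferred
to the first split of
CoherentDephasing: the momentum spectral function S_T(k,ω) of the infinite chain (topic
Literature/MathematicalPhysics/KineticTheory, over
InfiniteChainDynamics). No new bib entries (all keys in references.bib).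

Novelty: Searches (2026-08-15, this seat): `lit frontier AtomisticToContinuum --since 2021` (30 rows;
chain-relevant only arXiv:2310.13338 =
CanestrariLiveraniOlla2026 and arXiv:2604.14056 'Specific heat of thermally driven chains' — neither
on phonon lifetimes or the boundary
Kubo split); `lit search --source all` ×3 ('phonon mean free path … conductance length dependence',
'coherent incoherent phonon transport
Langevin chain Landauer', 'open system Kubo formula boundary driven Langevin chain') and `lit search
--hybrid` → searchd unavailable
(rc 75, 18:38–18:47Z, retried); `lit galaxy search "phonon mean free path anharmonic chain" --star
all` (0 hits), `"coherent and incoherent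
phonon" --star pdf` (4 nano-phononics hits, no theorem); the negatives index; all 108 FouriersLaw
cards via `ledger idea list`; the six
open route files and the two retired predecessors. Inherited (card + gen-0 route + refuter novelty
audit 04:34Z): crossref/hybrid queries
on phonon lifetime / coherent-incoherent transmission / kinetic limit of equilibrium time
correlations.
Nearest prior art found: LukkarinenSpohn2010 (doi:10.1007/s00222-010-0276-5) +
LukkarinenSpohn2010ICMP (doi:10.1142/9789814304634_0027) —
exponential damping of equilibrium time correlations of weakly nonlinear lattice waves with Gibbs
data on the KINETIC scale only;
Spohn2006PhononBoltzmann (doi:10.1007/s10955-005-8088-5, kinetic programme for the pinned quartic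
chain); JaksicPillet1998
(doi:10.1007/bf02392587, Koopman Liouvillean of one  [refs: 10.1007/s00222-010-0276-5, 10.1142/9789814304634_0027, 10.1007/s10955-005-8088-5, 10.1007/bf02392587, 10.1103/physreve.88.012128, 2310.13338, 2604.14056, 0809.4543, doi:10.1007/s00222-010-0276-5, doi:10.1142/9789814304634_0027, doi:10.1007/s10955-005-8088-5, doi:10.1007/bf02392587, doi:10.1103/physreve.88.012128, CanestrariLiveraniOlla2026, LukkarinenSpohn2010, JaksicPillet1998, KunduDharNarayan20]

Barriers (technique_class: one-phonon-sector fgr-dephasing boundary-kubo cumulant-split): - technique_class: one-phonon-sector fgr-dephasing boundary-kubo cumulant-split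
- Literature.Barriers.AtomisticToContinuum.HarmonicChainBallisticFlux: absorbed exactly — at lam = β
= 0 the process is Gaussian, cum₄ ≡ 0, G_N = G_N^coh does not decay (support
HarmonicCoherentPersistence states it); CoherentDephasing is precisely what must fail there and no
uniformity in (lam, β) is claimed.
- Literature.Barriers.AtomisticToContinuum.LowTemperatureWeakAnharmonicity: respected — ℓ(T) ~
(lam·T)⁻² and N₀(ε,T) blow up as T → 0; the regime item is stated in the effective couplings (lam·T,
β·T) that the proved conjugacy dictates; nothing T-uniform is asserted.
- Literature.Barriers.AtomisticToContinuum.Mazur1969_inequality: by phase-space inversion parity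
only an ODD conserved quantity can keep r_N from dephasing; pinning removes total momentum; an odd
hidden charge would refute CoherentDephasing visibly (kill criterion) — exposed in a two-point
observable, not assumed away; for IncoherentChannel the barrier applies as to any Kubo statement.
- Literature.Barriers.AtomisticToContinuum.HasBoundedResponse: CoherentDephasing delivers the
coherent part of bounded response by a mechanism (dephasing of a two-point function, infinite-volume
in nature) that is not fixed-N analysis; IncoherentChannel / IncoherentBounded do NOT evade it — the
bet is that boundary localisation of the four-point function at the dissipative sites lets
hypocoercive/Malliavin estimates bite uniformly in N.
- Literatu

History (route lifecycle, newest last):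
- 2026-08-24T07:12:59Z · DORMANT — reconciler: no traction for 6.6 d (last activity item-evidence-added at 2026-08-17T16:50:49Z); parked, not closed — `ledger route dormant route-AtomisticToConti (operator:999:4126231)

sub-problem: FouriersLaw · status: dormant · opened planner-plancard-AtomisticToContinuum-Fourier-90f149a3-g2-0 2026-08-15T18:43:56Z · rev 2 · ledger route-AtomisticToContinuum-PhononMeanFreePath
GENERATED by the gate from the ledger (D-0016/17). Provers cite these decls: `theorem foo : Summit.AtomisticToContinuum.FouriersLaw.Theses.PhononMeanFreePath.<Decl> := …` in Summits/AtomisticToContinuum/FouriersLaw/Theorems/<Name>.lean.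
-/

namespace Summit.AtomisticToContinuum.FouriersLaw.Theses.PhononMeanFreePath

open scoped BigOperators Topology Manifold Classical MeasureTheory ProbabilityTheory Matrix InnerProductSpace ComplexConjugate ContinuousMap
open Filter Set Function TopologicalSpace MeasureTheory

attribute [summit_statement] _root_.FouriersLaw

/-- item stmt-AtomisticToContinuum-11810 · crux · rank 2 · open · by planner
why it might fail: Needs N-uniform dephasing of the AVERAGED response at FIXED coupling beyond kinetic times (LS2010 stop at t~λ⁻²); a band with vanishing thermal scattering, finite-N transmission resonances or coherent nonlinear carriers would leave ≥ c/N; ℓ(T)~(lam·T)⁻², nothing uniform in T.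
sources: LukkarinenSpohn2010, LukkarinenSpohn2010ICMP, Lukkarinen2016, AokiLukkarinenSpohn2006, Spohn2006PhononBoltzmann, JaksicPillet1998
[crux] COHERENT (LANDAUER) CHANNEL CLOSES (card phonon-lifetime N3/N4 = card two-channel-dephasing
NA; signature of stmt-3303 verbatim): for all ω₂, lam, β, γ > 0 and T > 0, t ↦ r_N(t)² is integrable
on (0,∞) for every N and N·∫₀^∞ r_N(t)² dt → 0 as N → ∞ (conjecturally ≤ C N e^(−N/ℓ(T)), ℓ ~
(lam·T)⁻² the thermal phonon mean free path); equivalently the coherent channel N·G^coh =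
2γ²T⁻²N∫r_N² closes. r_N(t)/T is the Gibbs- and noise-averaged response of p_N at time t to a unit
kick on p_0 (classical FDT); at lam = β = 0 it does NOT close (HarmonicCoherentPersistence).
Engines: (i) FGR/positive commutators for the k-fibred phonon branch of the thermal Koopman
generator of the infinite chain + contact transfer; (ii) averaged tangent flow = wave in
self-generated dynamic disorder, Dyson resummation controlled by the gapped 1-D transfer operator;
(iii) inhomogeneous dephasing / De Roeck–Huveneers decoupling at strong anharmonicity. [difficulty:
XL] -/
@[route_item "route-AtomisticToContinuum-PhononMeanFreePath", crux]
def CoherentDephasing : Prop :=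
  ∀ ω₂ lam β γ : ℝ, 0 < ω₂ → 0 < lam → 0 < β → 0 < γ → ∀ T : ℝ, 0 < T → (∀ N : ℕ, MeasureTheory.IntegrableOn (fun t : ℝ => (∫ z, z.2 0 * (∫ y, y.2 (Fin.last N) ∂((Literature.MathematicalPhysics.KineticTheory.HeatConduction.pinnedChain ω₂ lam β γ).transitionKernel (N + 1) T T t.toNNReal z)) ∂((Literature.MathematicalPhysics.KineticTheory.HeatConduction.pinnedChain ω₂ lam β γ).gibbsMeasure (N + 1) T)) ^ 2) (Set.Ioi 0)) ∧ Filter.Tendsto (fun N : ℕ => (N : ℝ) * ∫ t in Set.Ioi (0 : ℝ), (∫ z, z.2 0 * (∫ y, y.2 (Fin.last N) ∂((Literature.MathematicalPhysics.KineticTheory.HeatConduction.pinnedChain ω₂ lam β γ).transitionKernel (N + 1) T T t.toNNReal z)) ∂((Literature.MathematicalPhysics.KineticTheory.HeatConduction.pinnedChain ω₂ lam β γ).gibbsMeasure (N + 1) T)) ^ 2) Filter.atTop (nhds 0)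

/-- item stmt-AtomisticToContinuum-11811 · crux · rank 3 · open · by planner
why it might fail: Green–Kubo depth in boundary clothes: an N-uniform bound on a TIME-INTEGRATED connected 4-point function over t~N², existence of the limit AND κ>0, while fixed-N mixing rates close (L² gap ≲ N⁻³ harmonically, BeckerMenegaki2022); an odd hidden charge makes it diverge.
sources: BonettoLebowitzReyBellet2000, KunduDharNarayan2009, JaksicOgataPillet2006, MaesNetocnyVerschuere2003, BeckerMenegaki2022, SaaskilahtiEtAl2012
[crux] INCOHERENT (FOUR-POINT) CHANNEL CARRIES κ (card two-channel-dephasing NB; stmt-3304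
verbatim): for all parameters > 0 and T > 0 there is κ(T) > 0, chosen before N, with
N·(γ²/T²)∫₀^∞[C_N(t) − 2r_N(t)²] dt → κ(T) as N → ∞, i.e. the time-integrated connected fourth
cumulant cum₄(p_0(0),p_0(0),p_N(t),p_N(t)) of the two END momenta of the equilibrium open chain
decays exactly like κ(T)T²/(γ²N) (junk-robust: a non-integrable summand gives 0, incompatible with κ
> 0). With BoundaryKubo and CoherentDephasing this is D_N → κ(T); stand-alone it is an
equilibrium-dynamics statement about two bath-site observables, the coordinates on which the
dissipative part of the generator acts, integrated over diffusive times t ~ N². [deps: BoundaryKubo,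
CoherentDephasing] [difficulty: open-problem] -/
@[route_item "route-AtomisticToContinuum-PhononMeanFreePath", crux]
def IncoherentChannel : Prop :=
  ∀ ω₂ lam β γ : ℝ, 0 < ω₂ → 0 < lam → 0 < β → 0 < γ → ∀ T : ℝ, 0 < T → ∃ κ : ℝ, 0 < κ ∧ Filter.Tendsto (fun N : ℕ => (N : ℝ) * (γ ^ 2 / T ^ 2) * ∫ t in Set.Ioi (0 : ℝ), ((∫ z, (z.2 0) ^ 2 * (∫ y, (y.2 (Fin.last N)) ^ 2 ∂((Literature.MathematicalPhysics.KineticTheory.HeatConduction.pinnedChain ω₂ lam β γ).transitionKernel (N + 1) T T t.toNNReal z)) ∂((Literature.MathematicalPhysics.KineticTheory.HeatConduction.pinnedChain ω₂ lam β γ).gibbsMeasure (N + 1) T)) - (∫ z, (z.2 0) ^ 2 ∂((Literature.MathematicalPhysics.KineticTheory.HeatConduction.pinnedChain ω₂ lam β γ).gibbsMeasure (N + 1) T)) * (∫ z, (∫ y, (y.2 (Fin.last N)) ^ 2 ∂((Literature.MathematicalPhysics.KineticTheory.HeatConduction.pinnedChain ω₂ lam β γ).transitionKernel (N + 1) T T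 t.toNNReal z)) ∂((Literature.MathematicalPhysics.KineticTheory.HeatConduction.pinnedChain ω₂ lam β γ).gibbsMeasure (N + 1) T)) - 2 * (∫ z, z.2 0 * (∫ y, y.2 (Fin.last N) ∂((Literature.MathematicalPhysics.KineticTheory.HeatConduction.pinnedChain ω₂ lam β γ).transitionKernel (N + 1) T T t.toNNReal z)) ∂((Literature.MathematicalPhysics.KineticTheory.HeatConduction.pinnedChain ω₂ lam β γ).gibbsMeasure (N + 1) T)) ^ 2)) Filter.atTop (nhds κ)

/-- item stmt-AtomisticToContinuum-11812 · crux · rank 4 · closed · proved by Summit.AtomisticToContinuum.FouriersLaw.Theorems.PhononMeanFreePathBoundaryKubo.boundaryKubo_proof (prover) · by planner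
why it might fail: Fixed-N yet unproved for Langevin baths: δ-differentiability of the weak NESS mean of γp_N² at equilibrium (HairerMajda2009 Ass. 1–3; their SDE Thm 4.4 Ass. 5 fails for cubic forces), Dynkin/IBP beyond C_c^∞, Gibbs invariance of the kernels; a slip breaks only the constant.
sources: KunduDharNarayan2009, JaksicOgataPillet2006, MaesNetocnyVerschuere2003, ReyBellet2003, HairerMajda2009, CuneoEckmannHairerReyBellet2018
[crux] BOUNDARY (CROSS-FORM) KUBO IDENTITY (card two-channel-dephasing N0; stmt-3305 verbatim): for
all parameters > 0, ASSUMING uniqueness of weak steady states (hypothesis = NessUnique): for every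
steady-state family μ, T > 0 and N, C_N ∈ L¹(0,∞) and totalCurrent(μ (N+1) (T+δ/2) (T−δ/2))/δ →
N·(γ²/T²)·∫₀^∞ C_N as δ → 0, δ ≠ 0 (existence AND value of BLR's D_(N+1); the empty chain has D = 0
by totalCurrent_zero). Derivation: ∂_(T_L)L = γ∂²_(p_0) and Gaussian IBP give ∂_(T_L)μ(A) =
(γ/T²)∫₀^∞ Cov_μ₀(p_0², K_t A) dt; A = γ(p_N² − T_R) is the power absorbed by the right bath = J̃ in
a steady state; the symmetric protocol equals ∂_(T_L)J̃ by the left/right reflection symmetry of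
pinnedChain (U uniform, V even); totalCurrent = N·J̃. Harmonic check: Gaussian ⇒ cum₄ = 0 ⇒ G_N =
2γ²T⁻²∫r_N² = Landauer (card two-channel-dephasing: 5-digit numerical agreement). [deps: NessUnique]
[difficulty: L] -/
@[route_item "route-AtomisticToContinuum-PhononMeanFreePath", crux]
def BoundaryKubo : Prop :=
  ∀ ω₂ lam β γ : ℝ, 0 < ω₂ → 0 < lam → 0 < β → 0 < γ → (∀ (N : ℕ) (T_L T_R : ℝ), 0 < T_L → 0 < T_R → ∀ μ ν : MeasureTheory.Measure (Literature.MathematicalPhysics.KineticTheory.HeatConduction.PhaseSpace N), (Literature.MathematicalPhysics.KineticTheory.HeatConduction.pinnedChain ω₂ lam β γ).IsSteadyState N T_L T_R μ → (Literature.MathematicalPhysics.KineticTheory.HeatConduction.pinnedChain ω₂ lam β γ).IsSteadyState N T_L T_R ν → μ = ν) → ∀ μ : (N : ℕ) → ℝ → ℝ → MeasureTheory.Measure (Literature.MathematicalPhysics.KineticTheory.HeatConduction.PhaseSpace N), (∀ (N : ℕ) (T_L T_R : ℝ), 0 < T_L → 0 < T_R → (Literature.MathematicalPhysics.KineticTheory.HeatConduction.pinnedChain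 ω₂ lam β γ).IsSteadyState N T_L T_R (μ N T_L T_R)) → ∀ T : ℝ, 0 < T → ∀ N : ℕ, MeasureTheory.IntegrableOn (fun t : ℝ => (∫ z, (z.2 0) ^ 2 * (∫ y, (y.2 (Fin.last N)) ^ 2 ∂((Literature.MathematicalPhysics.KineticTheory.HeatConduction.pinnedChain ω₂ lam β γ).transitionKernel (N + 1) T T t.toNNReal z)) ∂((Literature.MathematicalPhysics.KineticTheory.HeatConduction.pinnedChain ω₂ lam β γ).gibbsMeasure (N + 1) T)) - (∫ z, (z.2 0) ^ 2 ∂((Literature.MathematicalPhysics.KineticTheory.HeatConduction.pinnedChain ω₂ lam β γ).gibbsMeasure (N + 1) T)) * (∫ z, (∫ y, (y.2 (Fin.last N)) ^ 2 ∂((Literature.MathematicalPhysics.KineticTheory.HeatConduction.pinnedChain ω₂ lam β γ).transitionKernel (N + 1) T T t.toNNReal z)) ∂((Literature.MathematicalPhysics.KineticTheory.HeatConduction.pinnedChain ω₂ lam β γ).gibbsMeasure (N + 1) T))) (Set.Ioi 0) ∧ Filter.Tendsto (fun δ : ℝ => (Literature.MathematicalPhysics.KineticTheory.HeatConduction.pinnedChain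 ω₂ lam β γ).totalCurrent (μ (N + 1) (T + δ / 2) (T - δ / 2)) / δ) (nhdsWithin 0 {(0 : ℝ)}ᶜ) (nhds ((N : ℝ) * (γ ^ 2 / T ^ 2) * ∫ t in Set.Ioi (0 : ℝ), ((∫ z, (z.2 0) ^ 2 * (∫ y, (y.2 (Fin.last N)) ^ 2 ∂((Literature.MathematicalPhysics.KineticTheory.HeatConduction.pinnedChain ω₂ lam β γ).transitionKernel (N + 1) T T t.toNNReal z)) ∂((Literature.MathematicalPhysics.KineticTheory.HeatConduction.pinnedChain ω₂ lam β γ).gibbsMeasure (N + 1) T)) - (∫ z, (z.2 0) ^ 2 ∂((Literature.MathematicalPhysics.KineticTheory.HeatConduction.pinnedChain ω₂ lam β γ).gibbsMeasure (N + 1) T)) * (∫ z, (∫ y, (y.2 (Fin.last N)) ^ 2 ∂((Literature.MathematicalPhysics.KineticTheory.HeatConduction.pinnedChain ω₂ lam β γ).transitionKernel (N + 1) T T t.toNNReal z)) ∂((Literature.MathematicalPhysics.KineticTheory.HeatConduction.pinnedChain ω₂ lam β γ).gibbsMeasure (N + 1) T)))))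

/-- item stmt-AtomisticToContinuum-0741 · support · rank 9 · closed · proved by Summit.AtomisticToContinuum.FouriersLaw.Theorems.nessUnique_proof (prover) · by planner
sources: CuneoEckmannHairerReyBellet2018, Carmona2007
[crux] UNIQUENESS OF THE WEAK STEADY STATE (the half of stmt-0706 not covered by the landed fact
Literature.MathematicalPhysics.KineticTheory.HeatConduction.CuneoEckmannHairerReyBellet2018_pinnedChain,
p3544): for pinnedChain ω₂ lam β γ (all > 0), every N and T_L, T_R > 0, any two measures in the weak
Fokker–Planck class IsSteadyState (probability, ∫ L f dμ = 0 for f ∈ C_c^∞, bond currents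
integrable) coincide. Print: uniqueness of the INVARIANT MEASURE of the Langevin semigroup
(CuneoEckmannHairerReyBellet2018 Thm 2.13(1): C1, C2, CA; Carmona2007 Thm 1.1(iii)); the item
additionally needs 'weak stationary probability solution of L*μ = 0 ⇒ P_t-invariant' for this
hypoelliptic L with cubic drift (Echeverría 1982 well-posed martingale problem on C_c^∞ +
non-explosion via e^{θH}; Bogachev–Krylov–Röckner–Shaposhnikov 2015 Ch. 5 is non-degenerate only) —
the FP-identification lemma is the formal crux. N = 0: PhaseSpace 0 is a point (unique probability
measure); N = 1: both baths on site 0, OU at temperature (T_L+T_R)/2. This is exactly the hypothesis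
of FiniteResponse and ThermodynamicLimit and, with the fact, gives clause (i) of FouriersLawFor. -/
@[route_item "route-AtomisticToContinuum-PhononMeanFreePath", crux]
def NessUnique : Prop :=
  ∀ ω₂ lam β γ : ℝ, 0 < ω₂ → 0 < lam → 0 < β → 0 < γ → ∀ (N : ℕ) (T_L T_R : ℝ), 0 < T_L → 0 < T_R → ∀ μ ν : MeasureTheory.Measure (Literature.MathematicalPhysics.KineticTheory.HeatConduction.PhaseSpace N), (Literature.MathematicalPhysics.KineticTheory.HeatConduction.pinnedChain ω₂ lam β γ).IsSteadyState N T_L T_R μ → (Literature.MathematicalPhysics.KineticTheory.HeatConduction.pinnedChain ω₂ lam β γ).IsSteadyState N T_L T_R ν → μ = ν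

/-- `NessUnique` holds: proved by `Summit.AtomisticToContinuum.FouriersLaw.Theorems.nessUnique_proof`. -/
theorem NessUnique_holds : NessUnique := _root_.Summit.AtomisticToContinuum.FouriersLaw.Theorems.nessUnique_proof

/-- item stmt-AtomisticToContinuum-11071 · support · rank 9 · open · by planner
sources: BonettoLebowitzReyBellet2000, BonettoLebowitzLukkarinenOlla2009
[support] SHARED-WAYPOINT CONTENT, WRITTEN OUT (=
`Literature.Barriers.AtomisticToContinuum.HasBoundedResponse (pinnedChain ω₂ lam β γ)` for all
parameters > 0 — definiens verbatim; `hasBoundedResponse_iff` is `Iff.rfl`, so the old and the new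
decl are definitionally equal: planner SketchIff.lean `example : New = Old := rfl`, rc 0): along
EVERY steady-state family μ (IsSteadyState class, no uniqueness assumed) and every T > 0, if the
finite-N response limits D_N = lim_{δ→0, δ≠0} totalCurrent(μ_{N,T+δ/2,T−δ/2})/δ exist for all N,
then (|D_N|)_N is bounded — BLR2000 §6.3's missing 'dependence of D on L' in its weakest
quantitative form. In THIS route it is an OUTPUT (TransferToBoundedResponse 9655, candidate proof
attached) consumed by `closes`; open-problem as a standalone target. Cone repair 2026-08-15
(route-repair gen 2): the Barriers PREDICATE carries [cite] doc tags and no `_holds` (it is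
vocabulary, explicit binder P), so the staffability audit (#h21_route_deps, D-0027 §2.1 amended)
lists it as an unproved cite-only dependency (confirmed on sibling route OddSectorIrreversibility
rev 2→3, now staffable); unfolding removes the name from the decl cone without changing the stateme -/
@[route_item "route-AtomisticToContinuum-PhononMeanFreePath"]
def BoundedResponse : Prop :=
  ∀ ω₂ lam β γ : ℝ, 0 < ω₂ → 0 < lam → 0 < β → 0 < γ → ∀ μ : (N : ℕ) → ℝ → ℝ → MeasureTheory.Measure (Literature.MathematicalPhysics.KineticTheory.HeatConduction.PhaseSpace N), (∀ (N : ℕ) (T_L T_R : ℝ), 0 < T_L → 0 < T_R → (Literature.MathematicalPhysics.KineticTheory.HeatConduction.pinnedChain ω₂ lam β γ).IsSteadyState N T_L T_R (μ N T_L T_R)) → ∀ T : ℝ, 0 < T → ∀ D : ℕ → ℝ, (∀ N : ℕ, Filter.Tendsto (fun δ : ℝ => (Literature.MathematicalPhysics.KineticTheory.HeatConduction.pinnedChain ω₂ lam β γ).totalCurrent (μ N (T + δ / 2) (T - δ / 2)) / δ) (nhdsWithin 0 {(0 : ℝ)}ᶜ) (nhds (D N))) → BddAbove (Set.range fun N =>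 |D N|)

/-- item stmt-AtomisticToContinuum-11813 · support · rank 9 · open · by planner
sources: LukkarinenSpohn2010, JaksicPillet1998, Merkli2001, BachFrohlichSigal2000, Lukkarinen2016, AokiLukkarinenSpohn2006
[support] REGIME SPECIAL CASE OF THE RANK-2 CRUX (card phonon-lifetime N2, the Mourre/FGR corner;
NEW signature): for every ω₂, γ > 0 there is ε₀(ω₂,γ) > 0 such that the conclusion of
CoherentDephasing holds for all lam, β, T > 0 with lam·T ≤ ε₀ and β·T ≤ ε₀ (by the proved scaling
conjugacy (lam,β,T) ≡ (lam·T, β·T, 1) the statement depends on the two effective couplings only; ℓ ~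
(lam·T)⁻² may blow up as ε₀ → 0, only N → ∞ at fixed parameters is asserted). The stand-alone
publishable target 'finite thermal phonon lifetime beyond the kinetic time at fixed small coupling';
foreseen child of a regime split of CoherentDephasing (planner Sketch: CoherentDephasing →
CoherentDephasingWeakCoupling, rfl-level). [difficulty: XL] -/
@[route_item "route-AtomisticToContinuum-PhononMeanFreePath", crux]
def CoherentDephasingWeakCoupling : Prop :=
  ∀ ω₂ γ : ℝ, 0 < ω₂ → 0 < γ → ∃ ε₀ : ℝ, 0 < ε₀ ∧ ∀ lam β T : ℝ, 0 < lam → 0 < β → 0 < T → lam * T ≤ ε₀ → β * T ≤ ε₀ → (∀ N : ℕ, MeasureTheory.IntegrableOn (fun t : ℝ => (∫ z, z.2 0 * (∫ y, y.2 (Fin.last N) ∂((Literature.MathematicalPhysics.KineticTheory.HeatConduction.pinnedChain ω₂ lam β γ).transitionKernel (N + 1) T T t.toNNReal z)) ∂((Literature.MathematicalPhysics.KineticTheory.HeatConduction.pinnedChain ω₂ lam β γ).gibbsMeasure (N + 1) T)) ^ 2) (Set.Ioi 0)) ∧ Filter.Tendsto (fun N : ℕ => (N : ℝ) * ∫ t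 in Set.Ioi (0 : ℝ), (∫ z, z.2 0 * (∫ y, y.2 (Fin.last N) ∂((Literature.MathematicalPhysics.KineticTheory.HeatConduction.pinnedChain ω₂ lam β γ).transitionKernel (N + 1) T T t.toNNReal z)) ∂((Literature.MathematicalPhysics.KineticTheory.HeatConduction.pinnedChain ω₂ lam β γ).gibbsMeasure (N + 1) T)) ^ 2) Filter.atTop (nhds 0)

/-- item stmt-AtomisticToContinuum-11814 · support · rank 9 · closed · proved by Summit.AtomisticToContinuum.FouriersLaw.Theorems.HarmonicCoherentPersistence.harmonicCoherentPersistence_proof (prover) · by planner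
sources: RiederLebowitzLieb1967, Nakazawa1970, CasherLebowitz1971, Dhar2008, RoyDhar2008
[support] CALIBRATION / NEGATIVE SIDE AT THE INTEGRABLE CORNER (stmt-3306 verbatim): for the pinned
HARMONIC chain (lam = β = 0; ω₂, γ, T > 0) the coherent channel does NOT close: r_N² ∈ L¹ for all N
and ¬(N∫₀^∞ r_N² → 0) — indeed 2γ²T⁻²∫r_N² is the Rieder–Lebowitz–Lieb/Landauer conductance c_N →
c_∞ > 0 (the OU process is Gaussian, cum₄ ≡ 0; Parseval on the transmission formula). Checks that
r_N is typed with the right normalisation and that CoherentDephasing is exactly the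
harmonic/anharmonic divide; provable from LinearLangevinGaussian +
HarmonicChainNESS/HarmonicChainFlux once the OU kernels are identified with transitionKernel at lam
= β = 0. [difficulty: M] -/
@[route_item "route-AtomisticToContinuum-PhononMeanFreePath"]
def HarmonicCoherentPersistence : Prop :=
  ∀ ω₂ γ : ℝ, 0 < ω₂ → 0 < γ → ∀ T : ℝ, 0 < T → (∀ N : ℕ, MeasureTheory.IntegrableOn (fun t : ℝ => (∫ z, z.2 0 * (∫ y, y.2 (Fin.last N) ∂((Literature.MathematicalPhysics.KineticTheory.HeatConduction.pinnedChain ω₂ 0 0 γ).transitionKernel (N + 1) T T t.toNNReal z)) ∂((Literature.MathematicalPhysics.KineticTheory.HeatConduction.pinnedChain ω₂ 0 0 γ).gibbsMeasure (N + 1) T)) ^ 2) (Set.Ioi 0)) ∧ ¬ Filter.Tendsto (fun N : ℕ => (N : ℝ) * ∫ t in Set.Ioi (0 : ℝ), (∫ z, z.2 0 * (∫ y, y.2 (Fin.last N) ∂((Literature.MathematicalPhysics.KineticTheory.HeatConduction.pinnedChain ω₂ 0 0 γ).transitionKernel (N + 1) T T t.toNNReal z)) ∂((Literature.MathematicalPhysics.KineticTheory.HeatConduction.pinnedChain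 ω₂ 0 0 γ).gibbsMeasure (N + 1) T)) ^ 2) Filter.atTop (nhds 0)

/-- item stmt-AtomisticToContinuum-11815 · support · rank 9 · open · by planner
sources: BonettoLebowitzReyBellet2000, BonettoLebowitzLukkarinenOlla2009, BeckerMenegaki2022
[support] THE INCOHERENT CHANNEL IS BOUNDED UNIFORMLY IN N (stmt-3307 verbatim; the finiteness half
of IncoherentChannel): for all parameters > 0 and T > 0, sup_N |N·(γ²/T²)·∫₀^∞(C_N − 2r_N²)| < ∞
(boundary localisation of the observables at the dissipative sites should let hypocoercive/Malliavin
estimates bite uniformly in N); with BoundaryKubo and CoherentDephasing it yields the catalogued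
waypoint BoundedResponse (ChannelsBoundedResponse). [difficulty: XL] -/
@[route_item "route-AtomisticToContinuum-PhononMeanFreePath"]
def IncoherentBounded : Prop :=
  ∀ ω₂ lam β γ : ℝ, 0 < ω₂ → 0 < lam → 0 < β → 0 < γ → ∀ T : ℝ, 0 < T → ∃ B : ℝ, ∀ N : ℕ, |(N : ℝ) * (γ ^ 2 / T ^ 2) * ∫ t in Set.Ioi (0 : ℝ), ((∫ z, (z.2 0) ^ 2 * (∫ y, (y.2 (Fin.last N)) ^ 2 ∂((Literature.MathematicalPhysics.KineticTheory.HeatConduction.pinnedChain ω₂ lam β γ).transitionKernel (N + 1) T T t.toNNReal z)) ∂((Literature.MathematicalPhysics.KineticTheory.HeatConduction.pinnedChain ω₂ lam β γ).gibbsMeasure (N + 1) T)) - (∫ z, (z.2 0) ^ 2 ∂((Literature.MathematicalPhysics.KineticTheory.HeatConduction.pinnedChain ω₂ lam β γ).gibbsMeasure (N + 1) T)) * (∫ z, (∫ y, (y.2 (Fin.last N)) ^ 2 ∂((Literature.MathematicalPhysics.KineticTheory.HeatConduction.pinnedChain ω₂ lam β γ).transitionKernel (N + 1) T T t.toNNReal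 z)) ∂((Literature.MathematicalPhysics.KineticTheory.HeatConduction.pinnedChain ω₂ lam β γ).gibbsMeasure (N + 1) T)) - 2 * (∫ z, z.2 0 * (∫ y, y.2 (Fin.last N) ∂((Literature.MathematicalPhysics.KineticTheory.HeatConduction.pinnedChain ω₂ lam β γ).transitionKernel (N + 1) T T t.toNNReal z)) ∂((Literature.MathematicalPhysics.KineticTheory.HeatConduction.pinnedChain ω₂ lam β γ).gibbsMeasure (N + 1) T)) ^ 2)| ≤ B

/-- item stmt-AtomisticToContinuum-11816 · support · rank 9 · closed · proved by Summit.AtomisticToContinuum.FouriersLaw.Theorems.channelsBoundedResponse_proof (prover) · by planner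
sources: BonettoLebowitzReyBellet2000
[support] PARTIAL ASSEMBLY (glue, PROVED in the planner's Sketch.lean as
channelsBoundedResponse_holds, ~35 lines, axioms propext/Classical.choice/Quot.sound): NessUnique →
BoundaryKubo → CoherentDephasing → IncoherentBounded → BoundedResponse (response coefficients
identified by tendsto_nhds_unique, D_(N+1) split by integral_sub, coherent part bounded because
convergent). [difficulty: provable-now] -/
@[route_item "route-AtomisticToContinuum-PhononMeanFreePath"]
def ChannelsBoundedResponse : Prop :=
  NessUnique → BoundaryKubo → CoherentDephasing → IncoherentBounded → BoundedResponse

/-- item stmt-AtomisticToContinuum-11817 · assembly · rank 1 · closed · proved by Summit.AtomisticToContinuum.FouriersLaw.Theorems.phononMeanFreePath_assembly_proof @ 50c2de0ce228 (prover) · by planner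
sources: BonettoLebowitzReyBellet2000, CuneoEckmannHairerReyBellet2018
[assembly] NessUnique → BoundaryKubo → CoherentDephasing → IncoherentChannel → FouriersLaw (the
sub-problem Statement decl); PROVED as theorem closes (D-0027 §2.1). -/
@[route_item "route-AtomisticToContinuum-PhononMeanFreePath"]
def Assembly : Prop :=
  NessUnique → BoundaryKubo → CoherentDephasing → IncoherentChannel → FouriersLaw

/-! D-0027 §2.1 — DECIDING THEOREM (planner-authored via `route open/edit --closes-file`; by planner-rrepair-AtomisticToContinuum-PhononMea-2c59bb31-g2-0 2026-08-15T19:39:46Z):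
its hypotheses are this route's items and its conclusion the sub-problem Statement (glue_lint), and it elaborates with this file. -/

@[closes "route-AtomisticToContinuum-PhononMeanFreePath"] theorem closes (hU : NessUnique) (hK : BoundaryKubo) (hA : CoherentDephasing) (hB : IncoherentChannel) :
    _root_.FouriersLaw := by
  -- real-analysis glue (inlined): splitting the Kubo integral into the two channels
  have integral_split : ∀ {C r : ℝ → ℝ}, MeasureTheory.IntegrableOn C (Set.Ioi 0) →
      MeasureTheory.IntegrableOn (fun t => r t ^ 2) (Set.Ioi 0) →
      ∫ t in Set.Ioi (0:ℝ), C t = (∫ t in Set.Ioi (0:ℝ), (C t - 2 * r t ^ 2)) + 2 * ∫ t in Set.Ioi (0:ℝ), r t ^ 2 := by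
    intro C r hC hr
    have h2 : MeasureTheory.IntegrableOn (fun t => 2 * r t ^ 2) (Set.Ioi 0) := hr.const_mul 2
    rw [MeasureTheory.integral_sub hC h2, MeasureTheory.integral_const_mul]
    ring
  -- limit glue (inlined): D (N+1) = incoherent + 2(γ²/T²)·coherent → κ + 0, re-indexed from N+1 sites to N
  have tendsto_glue : ∀ {Cf rf : ℕ → ℝ → ℝ} {g κ : ℝ},
      (∀ N, MeasureTheory.IntegrableOn (Cf N) (Set.Ioi 0)) →
      (∀ N, MeasureTheory.IntegrableOn (fun t => rf N t ^ 2) (Set.Ioi 0)) →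
      Filter.Tendsto (fun N : ℕ => (N : ℝ) * g * ∫ t in Set.Ioi (0:ℝ), (Cf N t - 2 * rf N t ^ 2)) Filter.atTop (nhds κ) →
      Filter.Tendsto (fun N : ℕ => (N : ℝ) * ∫ t in Set.Ioi (0:ℝ), rf N t ^ 2) Filter.atTop (nhds 0) →
      Filter.Tendsto (fun M : ℕ => ((M - 1 : ℕ) : ℝ) * g * ∫ t in Set.Ioi (0:ℝ), Cf (M - 1) t) Filter.atTop (nhds κ) := by
    intro Cf rf g κ hC hr hinc hcoh
    rw [← Filter.tendsto_add_atTop_iff_nat 1]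
    have h : ∀ N : ℕ, ((N + 1 - 1 : ℕ) : ℝ) * g * ∫ t in Set.Ioi (0:ℝ), Cf (N + 1 - 1) t =
        (N : ℝ) * g * (∫ t in Set.Ioi (0:ℝ), (Cf N t - 2 * rf N t ^ 2)) +
          2 * g * ((N : ℝ) * ∫ t in Set.Ioi (0:ℝ), rf N t ^ 2) := by
      intro N
      rw [Nat.add_sub_cancel, integral_split (hC N) (hr N)]
      ring
    simp_rw [h]
    simpa using hinc.add (hcoh.const_mul (2 * g))
  show ∀ ω₂ lam β γ : ℝ, 0 < ω₂ → 0 < lam → 0 < β → 0 < γ →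
    (Literature.MathematicalPhysics.KineticTheory.HeatConduction.pinnedChain ω₂ lam β γ).FouriersLawFor
  intro ω₂ lam β γ hω hl hβ hγ
  have huniq := hU ω₂ lam β γ hω hl hβ hγ
  refine ⟨fun N T_L T_R hL hR => ?_, ?_⟩
  · -- clause (i): existence (proved fact, N = 0 included) + uniqueness (item NessUnique)
    obtain ⟨μ, hμ⟩ := Literature.MathematicalPhysics.KineticTheory.HeatConduction.pinnedChain_exists_isSteadyState hω hl hβ hγ N hL hR
    exact ⟨μ, hμ, fun ν hν => huniq N T_L T_R hL hR ν μ hν hμ⟩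
  -- clause (ii)
  choose κf hκpos hκlim using (fun (T : ℝ) (hT : 0 < T) => hB ω₂ lam β γ hω hl hβ hγ T hT)
  refine ⟨fun T => if hT : 0 < T then κf T hT else 1, fun T hT => ?_, ?_⟩
  · simp only [dif_pos hT]
    exact hκpos T hT
  intro μ hμ T hT
  have hKT := hK ω₂ lam β γ hω hl hβ hγ huniq μ hμ T hT
  have hAT := hA ω₂ lam β γ hω hl hβ hγ T hT
  -- C_N (connected power–power correlation) and r_N (momentum pair correlation) of the (N+1)-site chain
  let Cf : ℕ → ℝ → ℝ := fun N t => (∫ z, (z.2 0) ^ 2 * (∫ y, (y.2 (Fin.last N)) ^ 2 ∂((Literature.MathematicalPhysics.KineticTheory.HeatConduction.pinnedChain ω₂ lam β γ).transitionKernel (N + 1) T T t.toNNReal z)) ∂((Literature.MathematicalPhysics.KineticTheory.HeatConduction.pinnedChain ω₂ lam β γ).gibbsMeasure (N + 1) T)) - (∫ z, (z.2 0) ^ 2 ∂((Literature.MathematicalPhysics.KineticTheory.HeatConduction.pinnedChain ω₂ lam β γ).gibbsMeasure (N + 1) T)) * (∫ z, (∫ y, (y.2 (Fin.last N)) ^ 2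 ∂((Literature.MathematicalPhysics.KineticTheory.HeatConduction.pinnedChain ω₂ lam β γ).transitionKernel (N + 1) T T t.toNNReal z)) ∂((Literature.MathematicalPhysics.KineticTheory.HeatConduction.pinnedChain ω₂ lam β γ).gibbsMeasure (N + 1) T))
  let rf : ℕ → ℝ → ℝ := fun N t => ∫ z, z.2 0 * (∫ y, y.2 (Fin.last N) ∂((Literature.MathematicalPhysics.KineticTheory.HeatConduction.pinnedChain ω₂ lam β γ).transitionKernel (N + 1) T T t.toNNReal z)) ∂((Literature.MathematicalPhysics.KineticTheory.HeatConduction.pinnedChain ω₂ lam β γ).gibbsMeasure (N + 1) T)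
  -- the response coefficients: D 0 = 0 (empty chain), D (N+1) = N (γ²/T²) ∫ C_N
  let D : ℕ → ℝ := fun M => ((M - 1 : ℕ) : ℝ) * (γ ^ 2 / T ^ 2) * ∫ t in Set.Ioi (0:ℝ), Cf (M - 1) t
  refine ⟨D, fun M => ?_, ?_⟩
  · cases M with
    | zero =>
      have h0 : D 0 = 0 := by simp [D]
      rw [h0]
      simp only [Literature.MathematicalPhysics.KineticTheory.HeatConduction.OscillatorChain.totalCurrent_zero, zero_div]
      exact tendsto_const_nhds
    | succ N =>
      have hN : D (N + 1) = (N : ℝ) * (γ ^ 2 / T ^ 2) * ∫ t in Set.Ioi (0:ℝ), Cf N t := by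
        simp [D]
      rw [hN]
      exact (hKT N).2
  · simp only [dif_pos hT]
    exact tendsto_glue (Cf := Cf) (rf := rf) (fun N => (hKT N).1) hAT.1 (hκlim T hT) hAT.2

end Summit.AtomisticToContinuum.FouriersLaw.Theses.PhononMeanFreePath
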